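import Literature.AlgebraicGeometry.Motives.LinesGenerateChowOneSumSq
import Literature.AlgebraicGeometry.Motives.QuadricLinearSectionLines
import HarnessLib

/-!
# Lines generate `CH₁` (Tian–Zong, Thm. 1.7): what remains after the proved cases

Book-keeping for the named fact `TianZong2014_chowOne_generatedByLines` (Tian–Zong, *One-cycles on
rationally connected varieties*, Compositio Math. 150 (2014), Thm. 1.7 for smooth complete
intersections): the tree PROVES it for every multidegree with `Σ (d_a - 1) ≤ 1`
(`TianZong2014_chowOne_generatedByLines_of_two_le_sum`, `Motives/QuadricLinearSectionLines`) and
for every multidegree with `Σ d_a² ≤ n + c` (Tian–Zong, Prop. 7.2, the product trick: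
`TianZong2014_chowOne_generatedByLines_of_sum_sq_le`, `Motives/LinesGenerateChowOneSumSq`). This
file records the conjunction: the fact follows from its remaining case
`2 ≤ Σ (d_a - 1)` and `n + c < Σ d_a²` (`TianZong2014_chowOne_generatedByLines_of_residual`) —
e.g. cubic hypersurfaces in `ℙ⁴, …, ℙ⁸` — whose printed proof (Tian–Zong §6: rational chain
connectedness of the space of lines through a general point, `CH₀` of the Fano scheme of lines,
divisibility via Jacobians of curves in `M̄_{0,0}(X, e)`) is not in the tree.

## References

* [TianZong2014] Z. Tian, H. R. Zong, *One-cycles on rationally connected varieties*, Compositio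
  Math. 150 (2014), Thm. 1.7, Prop. 7.2, §6.
-/

noncomputable section

open CategoryTheory AlgebraicGeometry MvPolynomial

universe u

namespace Literature.AlgebraicGeometry.Motives

/-- **Reduction of Tian–Zong Thm. 1.7 (complete intersections) to the case `2 ≤ Σ (d_a - 1)`,
`n + c < Σ d_a²`.** The named fact `TianZong2014_chowOne_generatedByLines` holds as soon as it
holds for the multidegrees not covered by the proved cases `Σ (d_a - 1) ≤ 1`
(`Motives/QuadricLinearSectionLines`) and `Σ d_a² ≤ n + c` (Tian–Zong Prop. 7.2,
`Motives/LinesGenerateChowOneSumSq`). [cite: TianZong2014, Thm. 1.7 and Prop. 7.2] -/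
theorem TianZong2014_chowOne_generatedByLines_of_residual
    (h : ∀ ⦃k : Type u⦄ [Field k] [IsAlgClosed k] [CharZero k] ⦃c : ℕ⦄ (n : ℕ) (d : Fin c → ℕ)
      ⦃X : SchemeOver k⦄ (F : Fin c → MvPolynomial (Fin (n + c + 1)) k)
      (i : X ⟶ projectiveSpace (n + c) k),
      letI := MvPolynomial.gradedAlgebra (σ := Fin (n + c + 1)) (R := k)
      IsSmoothProjective n X → (∀ a, (F a).IsHomogeneous (d a)) → (∀ a, 0 < d a) →
        IsNonsingularSystem k F → IsClosedImmersion i.left →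
          Set.range i.left.base =
            ProjectiveSpectrum.zeroLocus (MvPolynomial.homogeneousSubmodule (Fin (n + c + 1)) k)
              (Set.range F) →
            (∑ a, d a) + 1 ≤ n + c → 2 ≤ ∑ a, (d a - 1) → n + c < ∑ a, d a ^ 2 →
              ChowOneGeneratedByLines (n + c) i) :
    TianZong2014_chowOne_generatedByLines.{u} := by
  refine TianZong2014_chowOne_generatedByLines_of_two_le_sum ?_
  intro k _ _ _ c n d X F i hX hF hd hJ hi hV hdeg htwo
  by_cases hsq : ∑ a, d a ^ 2 ≤ n + c
  · exact TianZong2014_chowOne_generatedByLines_of_sum_sq_le n d F i hX hF hd hi hV hdeg hsq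
  · exact h n d F i hX hF hd hJ hi hV hdeg htwo (lt_of_not_ge hsq)

end Literature.AlgebraicGeometry.Motives

end
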